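import Summits.CriticalPhenomena.Ising3DConformalLimit.Theses.CanonicalBranchRefutation
import Summits.CriticalPhenomena.Ising3DConformalLimit.Theorems.SubPtolemyInterlacingSubPtolemyFloorLiminfThreeHalves
import HarnessLib

/-!
# Route `CanonicalBranchRefutation`, crux `InfraredExponentZero` (stmt-CriticalPhenomena-15521), line
# `registered`: the bet holds at exponent `1/2` along a subsequence, unconditionally

Helper file (`--supports stmt-CriticalPhenomena-15521`) of the line lead, THEOREM-ONLY. The load-bearing
registered stub of the line is

  `stub_sphereMass_growth : ∀ ε > 0, ∀ᶠ n, n^{1-ε} ≤ M(n)`,  `M(n) := ∑_{y ∈ ∂Λ_n} ⟨σ₀σ_y⟩⁺_{β_c}` on `ℤ³`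

(the shell-averaged form of `η(3) ≤ 0`; equivalent to the crux, expected FALSE). This file records the
strongest UNCONDITIONAL statement of that shape the tree supports:

* `sq_mul_criticalTwoPoint_axis_le_sphereMass` — Messager–Miracle-Solé from below:
  `m² ⟨σ₀σ_{3m e₁}⟩ ≤ M(m)` (`m ≥ 1`), since `⟨σ₀σ_y⟩ ≥ ⟨σ₀σ_{3m e₁}⟩` on `∂Λ_m`
  (`criticalTwoPoint_axis_sandwich`) and `#∂Λ_m ≥ m²`;
* `sphereMass_frequently_ge_rpow` — **for every `δ > 0`, `M(m) ≥ m^{1/2-δ}` for infinitely many `m`.**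
  This is the tree's unconditional liminf axis floor `∃ᶠ n, n^{-a} ≤ ⟨σ₀σ_{n e₁}⟩` for every `a > 3/2`
  (`SubPtolemyFloorPlusWall.frequently_rpow_le_criticalTwoPoint_axis`, i.e. Duminil-Copin–Panis 2025
  Theorem 1.3 at `β_c` run against an eventual power upper bound — their Theorem 1.5 "`η ≤ 1/2`" with the
  hypothesis "`η` exists" removed), transferred to shells: `M(⌊n/3⌋) ≥ ⌊n/3⌋² ⟨σ₀σ_{n e₁}⟩`.

So, for the sphere masses of the critical 3D Ising model: ALWAYS `c ≤ M(n) ≤ C n`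
(`sphereMass_window`, sibling file `…SphereMass.lean`); INFINITELY OFTEN `M(n) ≥ n^{1/2-δ}` (here); the BET
asks for `M(n) ≥ n^{1-ε}` EVENTUALLY. The gap `[1/2, 1]` in the exponent (and "frequently" vs "eventually")
is exactly the open content of the crux.

References: H. Duminil-Copin, R. Panis, *New lower bounds for the (near) critical Ising and φ⁴ models'
two-point functions*, CMP 406 (2025) = arXiv:2404.05700, Theorems 1.3 and 1.5
[DuminilCopinPanis2025LowerBounds]; A. Messager, S. Miracle-Solé, J. Stat. Phys. 17 (1977)
[MessagerMiracleSoleJSP1977].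
-/

noncomputable section

namespace Summit.CriticalPhenomena.Ising3DConformalLimit.Theorems

open Filter Topology Finset Literature.Probability.LatticeModels
open Summit.CriticalPhenomena.Ising3DConformalLimit.SubPtolemyFloorPlusWall
  (frequently_rpow_le_criticalTwoPoint_axis)

/-- **Messager–Miracle-Solé from below for sphere masses**: `m² ⟨σ₀σ_{3m e₁}⟩⁺_{β_c} ≤ ∑_{y ∈ ∂Λ_m} ⟨σ₀σ_y⟩⁺_{β_c}`
on `ℤ³` for `m ≥ 1` — every `y` with `‖y‖_∞ = m` has `⟨σ₀σ_y⟩ ≥ ⟨σ₀σ_{3m e₁}⟩` (MMS sphere sandwich,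
`criticalTwoPoint_axis_sandwich`), and `#∂Λ_m = (2m+1)³ - (2m-1)³ ≥ m²`.
[cite: DuminilCopin2019, §4.3 Exercise 37 (4), eq. (4.10)] -/
theorem sq_mul_criticalTwoPoint_axis_le_sphereMass {m : ℕ} (hm : 1 ≤ m) :
    (m : ℝ) ^ 2 * criticalTwoPoint 3 (Pi.single 0 ((3 * m : ℕ) : ℤ)) ≤
      ∑ y ∈ sphere 3 m, criticalTwoPoint 3 y := by
  have hterm : ∀ y ∈ sphere 3 m,
      criticalTwoPoint 3 (Pi.single 0 ((3 * m : ℕ) : ℤ)) ≤ criticalTwoPoint 3 y := by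
    intro y hy
    have hy' : Site.supNorm y = m := mem_sphere.1 hy
    have h := (criticalTwoPoint_axis_sandwich (y := y) (by omega)).1
    rwa [hy'] at h
  have hcard : (m : ℝ) ^ 2 ≤ (#(sphere 3 m) : ℝ) := by
    obtain ⟨k, rfl⟩ : ∃ k, m = k + 1 := ⟨m - 1, by omega⟩
    have h := card_sphere_succ_add (d := 3) k
    rw [card_box, card_box] at h
    have h' : (k + 1) ^ 2 ≤ #(sphere 3 (k + 1)) := by nlinarith [h]
    exact_mod_cast h'
  have hGnn : 0 ≤ criticalTwoPoint 3 (Pi.single 0 ((3 * m : ℕ) : ℤ)) :=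
    (criticalTwoPoint_axis_pos _).le
  calc (m : ℝ) ^ 2 * criticalTwoPoint 3 (Pi.single 0 ((3 * m : ℕ) : ℤ))
      ≤ (#(sphere 3 m) : ℝ) * criticalTwoPoint 3 (Pi.single 0 ((3 * m : ℕ) : ℤ)) :=
        mul_le_mul_of_nonneg_right hcard hGnn
    _ = ∑ _y ∈ sphere 3 m, criticalTwoPoint 3 (Pi.single 0 ((3 * m : ℕ) : ℤ)) := by
        rw [Finset.sum_const, nsmul_eq_mul]
    _ ≤ ∑ y ∈ sphere 3 m, criticalTwoPoint 3 y := Finset.sum_le_sum hterm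

/-- **The bet at exponent `1/2`, along a subsequence, unconditionally.** For every `δ > 0` the critical
sphere masses of the 3D Ising model satisfy `m^{1/2-δ} ≤ M(m) = ∑_{y ∈ ∂Λ_m} ⟨σ₀σ_y⟩⁺_{β_c}` for
infinitely many `m`. Proof: the tree's unconditional liminf axis floor (Duminil-Copin–Panis 2025,
Theorem 1.3 at `β_c` against an eventual power upper bound: for every `a > 3/2`, `n^{-a} ≤ ⟨σ₀σ_{n e₁}⟩`
infinitely often, `frequently_rpow_le_criticalTwoPoint_axis`) with `a = 3/2 + δ/2`, moved to the shell
`m = ⌊n/3⌋` by axial monotonicity (`3m ≤ n`) and `m² ⟨σ₀σ_{3m e₁}⟩ ≤ M(m)`: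
`M(m) ≥ m² n^{-a} ≥ 5^{-a} m^{2-a} ≥ m^{1/2-δ}` for `m` large. Compare: the registered stub
`stub_sphereMass_growth` of crux stmt-CriticalPhenomena-15521 bets `M(m) ≥ m^{1-ε}` EVENTUALLY (all `ε > 0`);
rigorously, eventually only `M(m) ≥ c` is known. [cite: DuminilCopinPanis2025LowerBounds, Theorem 1.3 and Theorem 1.5] -/
theorem sphereMass_frequently_ge_rpow :
    ∀ δ : ℝ, 0 < δ → ∃ᶠ m : ℕ in atTop,
      (m : ℝ) ^ (1 / 2 - δ) ≤ ∑ y ∈ sphere 3 m, criticalTwoPoint 3 y := by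
  intro δ hδ
  -- the axis floor with exponent `a = 3/2 + δ/2`, frequently
  set a : ℝ := 3 / 2 + δ / 2 with ha_def
  have ha : 3 / 2 < a := by rw [ha_def]; linarith
  have hfreq := frequently_rpow_le_criticalTwoPoint_axis a ha
  simp only [zsmul_single_zero_one] at hfreq
  -- eventually in `m`: `m^{1/2-δ} ≤ 5^{-a} m^{2-a}` (as `2 - a = 1/2 - δ/2`)
  have hev : ∀ᶠ m : ℕ in atTop, (m : ℝ) ^ (1 / 2 - δ) ≤ (5 : ℝ) ^ (-a) * (m : ℝ) ^ (2 - a) := by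
    have hpos : 0 < δ / 2 := by linarith
    have ht : Tendsto (fun m : ℕ => (m : ℝ) ^ (δ / 2)) atTop atTop :=
      (tendsto_rpow_atTop hpos).comp tendsto_natCast_atTop_atTop
    filter_upwards [ht.eventually_ge_atTop ((5 : ℝ) ^ a), eventually_ge_atTop 1] with m hm hm1
    have hm0 : (0 : ℝ) < m := by exact_mod_cast hm1
    have h5 : (0 : ℝ) < (5 : ℝ) ^ a := Real.rpow_pos_of_pos (by norm_num) _
    have hle : (m : ℝ) ^ (-(δ / 2)) ≤ (5 : ℝ) ^ (-a) := by
      rw [Real.rpow_neg hm0.le, Real.rpow_neg (by norm_num : (0 : ℝ) ≤ 5)]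
      exact inv_anti₀ h5 hm
    calc (m : ℝ) ^ (1 / 2 - δ) = (m : ℝ) ^ (2 - a) * (m : ℝ) ^ (-(δ / 2)) := by
          rw [← Real.rpow_add hm0, ha_def]
          ring_nf
      _ ≤ (m : ℝ) ^ (2 - a) * (5 : ℝ) ^ (-a) :=
          mul_le_mul_of_nonneg_left hle (Real.rpow_nonneg hm0.le _)
      _ = (5 : ℝ) ^ (-a) * (m : ℝ) ^ (2 - a) := mul_comm _ _
  obtain ⟨N₀, hN₀⟩ := eventually_atTop.1 hev
  rw [Filter.frequently_atTop]
  intro N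
  obtain ⟨n, hn, hgn⟩ := Filter.frequently_atTop.1 hfreq (3 * max (max N N₀) 1)
  -- the shell radius `m := ⌊n/3⌋`
  set m : ℕ := n / 3 with hm_def
  have hm3 : 3 * m ≤ n := Nat.mul_div_le n 3
  have hn3 : n < 3 * m + 3 := by omega
  have hmN : max (max N N₀) 1 ≤ m := by omega
  have hm1 : 1 ≤ m := le_of_max_le_right hmN
  have hmN' : N ≤ m := le_of_max_le_left (le_of_max_le_left hmN)
  have hmN₀ : N₀ ≤ m := le_of_max_le_right (le_of_max_le_left hmN)
  refine ⟨m, hmN', ?_⟩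
  have hm0 : (0 : ℝ) < m := by exact_mod_cast hm1
  have hn0 : (0 : ℝ) < n := by exact_mod_cast (show 0 < n by omega)
  -- `⟨σ₀σ_{n e₁}⟩ ≤ ⟨σ₀σ_{3m e₁}⟩` (axial monotonicity, `3m ≤ n`)
  have hanti : criticalTwoPoint 3 (Pi.single 0 (n : ℤ)) ≤
      criticalTwoPoint 3 (Pi.single 0 ((3 * m : ℕ) : ℤ)) :=
    criticalTwoPoint_axis_antitone hm3
  -- `n ≤ 3m + 2 ≤ 5m`, so `5^{-a} m^{-a} ≤ n^{-a}`
  have hn5 : (n : ℝ) ≤ 5 * m := by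
    have : n ≤ 5 * m := by omega
    exact_mod_cast this
  have hpow : (5 : ℝ) ^ (-a) * (m : ℝ) ^ (-a) ≤ (n : ℝ) ^ (-a) := by
    rw [← Real.mul_rpow (by norm_num) hm0.le, Real.rpow_neg (by positivity), Real.rpow_neg hn0.le]
    exact inv_anti₀ (Real.rpow_pos_of_pos hn0 _)
      (Real.rpow_le_rpow hn0.le hn5 (by rw [ha_def]; linarith))
  calc (m : ℝ) ^ (1 / 2 - δ) ≤ (5 : ℝ) ^ (-a) * (m : ℝ) ^ (2 - a) := hN₀ m hmN₀
    _ = (m : ℝ) ^ 2 * ((5 : ℝ) ^ (-a) * (m : ℝ) ^ (-a)) := by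
        rw [show (2 - a : ℝ) = 2 + -a by ring, Real.rpow_add hm0, Real.rpow_two]
        ring
    _ ≤ (m : ℝ) ^ 2 * (n : ℝ) ^ (-a) := mul_le_mul_of_nonneg_left hpow (by positivity)
    _ ≤ (m : ℝ) ^ 2 * criticalTwoPoint 3 (Pi.single 0 (n : ℤ)) :=
        mul_le_mul_of_nonneg_left hgn (by positivity)
    _ ≤ (m : ℝ) ^ 2 * criticalTwoPoint 3 (Pi.single 0 ((3 * m : ℕ) : ℤ)) :=
        mul_le_mul_of_nonneg_left hanti (by positivity)
    _ ≤ ∑ y ∈ sphere 3 m, criticalTwoPoint 3 y := sq_mul_criticalTwoPoint_axis_le_sphereMass hm1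

/-- **The window for the averaged exponent, liminf side.** No eventual strict upper bound
`M(m) < m^{1/2-δ}` (`δ > 0`) holds for the critical 3D sphere masses — the shell form of "`η(3) ≤ 1/2`
along a subsequence", unconditional (Duminil-Copin–Panis 2025 Thm 1.5 needs η to exist for the full
statement). [cite: DuminilCopinPanis2025LowerBounds, Theorem 1.5] -/
theorem not_eventually_sphereMass_lt_rpow {δ : ℝ} (hδ : 0 < δ) :
    ¬ ∀ᶠ m : ℕ in atTop, ∑ y ∈ sphere 3 m, criticalTwoPoint 3 y < (m : ℝ) ^ (1 / 2 - δ) := by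
  rw [Filter.not_eventually]
  exact (sphereMass_frequently_ge_rpow δ hδ).mono fun m hm => not_lt.2 hm

end Summit.CriticalPhenomena.Ising3DConformalLimit.Theorems
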